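import Summits.KontsevichZagierPeriods.KontsevichZagierPeriods.Theorems.HurwitzMicroSectorsNormalFormPrincipleQuadAlgebra
import Summits.KontsevichZagierPeriods.KontsevichZagierPeriods.Theorems.HurwitzMicroSectorsNormalFormPrincipleDimOneRatMultiple
import Summits.KontsevichZagierPeriods.KontsevichZagierPeriods.Theorems.HurwitzMicroSectorsNormalFormPrincipleBoxAlgSplitK4Algebra

/-!
# `StokesGeneration` (stmt-KontsevichZagierPeriods-3586) — line `fibrewise_stokes`, stub `stub_rawPartialFractions`

Registered rung stub (rung 8, W3) of the line `fibrewise_stokes` of the crux `StokesGeneration`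
(route UnfoldedStokes): **real partial fractions over the real algebraic numbers, pointwise**.

For `P, Q ∈ K[X]` (`K = algebraicClosure ℚ ℝ`, the real algebraic numbers) with `Q ≠ 0`: wherever
`Q(t) ≠ 0`,

`P/Q = E + Σᵢ cᵢ/(t − ρᵢ)^{kᵢ+1} + Σₗ (aₗ t + bₗ)/((t − uₗ)² + vₗ²)^{nₗ+1}`

with `E ∈ K[X]`, all constants in `K`, the `ρᵢ` roots of `Q` and `vₗ > 0`.

Proof: strong induction on `deg Q` (on a bound `d ≥ deg Q`, generalizing `P, Q`). A constant `Q = a`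
gives `P/Q = aeval t (C a⁻¹ * P)` with empty pole families. Otherwise `Q` divides the image of a
nonzero rational polynomial (`exists_dvd_map_of_ne_zero`), so it has a root in `K` or a factor
`(X − u)² + v²` with `v > 0` (`exists_root_or_quad`); one pole is peeled off (`exists_peel_poleK`,
resp. `exists_peel_quad`), leaving `P₁/Q₁` with `Q₁` a proper divisor of `Q`, and the new datum is
prepended to the corresponding family with `Fin.cons`. All four ingredients are landed files of route
HurwitzMicroSectors.

References: folklore (partial fractions over a real closed field); M. Kontsevich, D. Zagier,
*Periods* (2001), §1.2 for the use. No definitions are introduced.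
-/

noncomputable section

-- `Summit.KontsevichZagierPeriods.KontsevichZagierPeriods.…` is the tree's mandated layout (single-conjunct summit).
set_option linter.dupNamespace false

namespace Summit.KontsevichZagierPeriods.KontsevichZagierPeriods.Cruxes.StokesGeneration.FibrewiseStokes

open Finset
open scoped Polynomial
open Summit.KontsevichZagierPeriods.HurwitzMicroSectors.NormalFormPrinciple.PiBox.Dlog
  (exists_root_or_quad exists_peel_quad exists_dvd_map_of_ne_zero)
open Summit.KontsevichZagierPeriods.HurwitzMicroSectors.NormalFormPrinciple.BoxAlgSplitK4
  (exists_peel_poleK)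

/-- **Real partial fractions over `K`, bounded degree.** For `Q ≠ 0` in `K[X]`
(`K = algebraicClosure ℚ ℝ`) with `deg Q ≤ d` and any `P ∈ K[X]`: wherever `Q(t) ≠ 0`,
`P/Q = E + Σᵢ cᵢ/(t − ρᵢ)^{kᵢ+1} + Σₗ (aₗ t + bₗ)/((t − uₗ)² + vₗ²)^{nₗ+1}` with `E ∈ K[X]`, constants
in `K`, the `ρᵢ` roots of `Q` and `vₗ > 0` (induction on `d`, peeling one real pole or one real
quadratic factor at a time). [folklore] -/
theorem rawPartialFractions_of_natDegree_le (d : ℕ) (P Q : (algebraicClosure ℚ ℝ)[X]) (hQ : Q ≠ 0)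
    (hdeg : Q.natDegree ≤ d) :
    ∃ (E : Polynomial (algebraicClosure ℚ ℝ)) (m : ℕ) (c ρ : Fin m → algebraicClosure ℚ ℝ)
      (k : Fin m → ℕ) (m' : ℕ) (a b u v : Fin m' → algebraicClosure ℚ ℝ) (n : Fin m' → ℕ),
      (∀ i, Q.IsRoot (ρ i)) ∧ (∀ l, 0 < (v l : ℝ)) ∧
      ∀ t : ℝ, (Polynomial.aeval t Q : ℝ) ≠ 0 →
        (Polynomial.aeval t P : ℝ) / Polynomial.aeval t Q =
          Polynomial.aeval t E + ∑ i, (c i : ℝ) / (t - ρ i) ^ (k i + 1) +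
            ∑ l, ((a l : ℝ) * t + b l) / ((t - u l) ^ 2 + (v l : ℝ) ^ 2) ^ (n l + 1) := by
  -- adapted from `BoxAlgSplitK4.exists_partialFraction` (the split case)
  induction d generalizing P Q with
  | zero =>
    -- `Q` is a nonzero constant
    obtain ⟨a, rfl⟩ : ∃ a, Q = Polynomial.C a :=
      ⟨Q.coeff 0, Polynomial.eq_C_of_natDegree_le_zero hdeg⟩
    have ha : a ≠ 0 := fun h => hQ (by rw [h, map_zero])
    refine ⟨Polynomial.C a⁻¹ * P, 0, Fin.elim0, Fin.elim0, Fin.elim0, 0, Fin.elim0, Fin.elim0,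
      Fin.elim0, Fin.elim0, Fin.elim0, fun i => i.elim0, fun l => l.elim0, fun t _ => ?_⟩
    have ha' : algebraMap (algebraicClosure ℚ ℝ) ℝ a ≠ 0 := by
      rw [ne_eq, map_eq_zero_iff _ (algebraMap (algebraicClosure ℚ ℝ) ℝ).injective]
      exact ha
    simp only [Polynomial.aeval_C, map_mul, map_inv₀, Finset.univ_eq_empty, Finset.sum_empty,
      add_zero]
    field_simp
  | succ d ih =>
    by_cases hd : Q.natDegree ≤ d
    · exact ih P Q hQ hd
    have hpos : 0 < Q.natDegree := by omega
    -- `Q` divides a rational polynomial, hence has a real algebraic root or a real quadratic factor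
    obtain ⟨q₀, hq₀, hdvd₀⟩ := exists_dvd_map_of_ne_zero Q hQ
    -- bookkeeping shared by the two cases: roots and non-vanishing pass along a divisor
    have hrootq : ∀ {Q₁ : (algebraicClosure ℚ ℝ)[X]}, Q₁ ∣ Q → ∀ x, Q₁.IsRoot x → Q.IsRoot x :=
      fun hdvd x hx => hx.dvd hdvd
    have hQ₁t : ∀ {Q₁ : (algebraicClosure ℚ ℝ)[X]}, Q₁ ∣ Q → ∀ t : ℝ,
        (Polynomial.aeval t Q : ℝ) ≠ 0 → (Polynomial.aeval t Q₁ : ℝ) ≠ 0 := by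
      intro Q₁ hdvd t ht h
      obtain ⟨r, hr⟩ := hdvd
      apply ht
      rw [hr, map_mul, h, zero_mul]
    rcases exists_root_or_quad Q hpos hq₀ hdvd₀ with ⟨ρ, hρ⟩ | ⟨u, v, hv, hdvd⟩
    · -- a real algebraic root: peel the pole, prepend `(c, ρ, k)`
      obtain ⟨k, c, P₁, Q₁, hQ₁, hlt, hdvd, hpeel⟩ := exists_peel_poleK P Q hQ hρ
      obtain ⟨E, m, cc, ρρ, kk, m', a, b, uu, vv, n, hρρ, hvv, hsum⟩ :=
        ih P₁ Q₁ hQ₁ (by omega)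
      refine ⟨E, m + 1, Fin.cons c cc, Fin.cons ρ ρρ, Fin.cons k kk, m', a, b, uu, vv, n,
        Fin.cases (by simpa using hρ) (fun i => by simpa using hrootq hdvd _ (hρρ i)), hvv,
        fun t ht => ?_⟩
      rw [hpeel t ht, hsum t (hQ₁t hdvd t ht)]
      simp only [IntermediateField.algebraMap_apply, Fin.sum_univ_succ, Fin.cons_zero,
        Fin.cons_succ]
      ring
    · -- a real quadratic factor: peel it, prepend `(A, B, u, v, n)`
      obtain ⟨n, A, B, P₁, Q₁, hQ₁, hlt, hdvd', hpeel⟩ := exists_peel_quad P Q hQ hv.ne' hdvd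
      obtain ⟨E, m, cc, ρρ, kk, m', a, b, uu, vv, nn, hρρ, hvv, hsum⟩ :=
        ih P₁ Q₁ hQ₁ (by omega)
      refine ⟨E, m, cc, ρρ, kk, m' + 1, Fin.cons A a, Fin.cons B b, Fin.cons u uu, Fin.cons v vv,
        Fin.cons n nn, fun i => hrootq hdvd' _ (hρρ i),
        Fin.cases (by simpa using hv) (fun l => by simpa using hvv l), fun t ht => ?_⟩
      rw [hpeel t ht, hsum t (hQ₁t hdvd' t ht)]
      simp only [Fin.sum_univ_succ, Fin.cons_zero, Fin.cons_succ]
      ring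

/-- **Real partial fractions over the real algebraic numbers, pointwise** (registered stub
`stub_rawPartialFractions`, rung 8 of the line `fibrewise_stokes`). For `P, Q ∈ K[X]`
(`K = algebraicClosure ℚ ℝ`), `Q ≠ 0`: wherever `Q(t) ≠ 0`,
`P/Q = E + Σᵢ cᵢ/(t − ρᵢ)^{kᵢ+1} + Σₗ (aₗ t + bₗ)/((t − uₗ)² + vₗ²)^{nₗ+1}` with `E ∈ K[X]`, all
constants in `K`, the `ρᵢ` roots of `Q` and `vₗ > 0`. [folklore] -/
theorem stub_rawPartialFractions :
    ∀ (P Q : Polynomial (algebraicClosure ℚ ℝ)), Q ≠ 0 →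
      ∃ (E : Polynomial (algebraicClosure ℚ ℝ)) (m : ℕ) (c ρ : Fin m → algebraicClosure ℚ ℝ) (k : Fin m → ℕ)
        (m' : ℕ) (a b u v : Fin m' → algebraicClosure ℚ ℝ) (n : Fin m' → ℕ),
        (∀ i, Q.IsRoot (ρ i)) ∧ (∀ l, 0 < (v l : ℝ)) ∧
        ∀ t : ℝ, (Polynomial.aeval t Q : ℝ) ≠ 0 →
          (Polynomial.aeval t P : ℝ) / Polynomial.aeval t Q =
            Polynomial.aeval t E + ∑ i, (c i : ℝ) / (t - ρ i) ^ (k i + 1) +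
              ∑ l, ((a l : ℝ) * t + b l) / ((t - u l) ^ 2 + (v l : ℝ) ^ 2) ^ (n l + 1) :=
  fun P Q hQ => rawPartialFractions_of_natDegree_le Q.natDegree P Q hQ le_rfl

end Summit.KontsevichZagierPeriods.KontsevichZagierPeriods.Cruxes.StokesGeneration.FibrewiseStokes
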